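import Mathlib.Combinatorics.SimpleGraph.Connectivity.Subgraph
import Mathlib.Combinatorics.SimpleGraph.Paths
import Mathlib.Data.Finset.SymmDiff
import HarnessLib

/-!
# Walk surgery: splicing a self-avoiding path along a detour; a cycle through an edge is the
# edge plus a path

Generic combinatorics of walks in a simple graph (topic `Literature/Combinatorics/SimpleGraph`),
written for the proof of `Literature.Barriers.CriticalPhenomena.SupercriticalSAW.DKY2014_prop7_disk`
(`Literature/Barriers/CriticalPhenomena/SupercriticalSAWSpaceFillingBoxes.lean`; H. Duminil-Copin, G. Kozma, A. Yadin, *Supercritical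
self-avoiding walks are space-filling*, Ann. IHP Probab. Stat. 50 (2014) 315–326, arXiv:1110.3074,
proof of Proposition 7, p. 7: "consider the map `f` that associates to `(γ₁, γ₂) ∈ Θ_F × S_F` the
symmetric difference `γ = f(γ₁, γ₂)` of `γ₁`, `ℓ(γ₁)` and `γ₂` … the object that we obtain is a walk
from `a_δ` to `b_δ` in `Ω_δ`, which can be verified to be self-avoiding by noting that each vertex has
degree 0 or 2 and that the set is connected. Further, its length is equal to
`|γ₁| + |ℓ(γ₁)| + |γ₂| - 4` or `|γ₁| + |ℓ(γ₁)| + |γ₂| - 6`").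

The symmetric differences of the source are realised as explicit concatenations of walks:

* `exists_append_cons_of_mem_edges` — an edge of a walk splits the walk around it;
* `exists_edges_eq_pair_of_isPath`, `not_three_edges_of_isPath` — an interior vertex of a path has exactly
  two incident edges ("each vertex has degree 0 or 2"; Mathlib's
  `IsPath.ncard_neighborSet_toSubgraph_internal_eq_two`, unpacked);
* (a path is determined by its set of edges — the injectivity "once one knows `ℓ` this gives `γ₁`" —
  is already `Literature.Probability.RandomPlanarGeometry.SAW.eq_of_isPath_of_edges_toFinset_eq`);
* `isPath_splice`, `edges_toFinset_splice` — replacing a sub-walk `μ : v₁ → v₂` of a path by a path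
  `l : v₁ → v₂` meeting the path only at `v₁, v₂` gives a path, whose edge set is the symmetric
  difference with the closed polygon `μ ∪ l`;
* `exists_splice_edge`, `exists_splice_two_edges` — the two printed cases ("`ℓ` intersects `γ`
  either at just one edge, or at two adjacent edges only"): the new path has length
  `|γ| + |ℓ| - 2`, resp. `|γ| + |ℓ| - 4`, edge set `E(γ) Δ ℓ`, and its vertices are vertices of `γ`
  or of `ℓ`;
* `exists_path_of_isCycle_of_mem_edges` — a cycle through an edge `s(p, q)` is that edge plus a
  self-avoiding path from `p` to `q` (used for the polygons `γ₂ ∈ S_F` through the external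
  cardinal edge `e`).

Everything here is folklore graph theory (`[folklore]` tags); the module docstring records the use.
Mathlib has walks, paths, cycles, `takeUntil`/`dropUntil`/`rotate`/`transfer` and the degree count
`IsPath.ncard_neighborSet_toSubgraph_internal_eq_two`, but no splicing lemma (searched `splice`, `symmDiff` with `Walk`, `eq_of_edges`).
-/

namespace Literature.Combinatorics.SimpleGraph

open _root_.SimpleGraph

variable {V : Type*} {G : _root_.SimpleGraph V}

/-! ### Splitting a walk at an edge; edges at a vertex of a path -/

/-- An edge of a walk splits it: `p = q ++ (x' → y') ++ r` with `s(x', y') = s(x, y)` (the edge may be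
traversed in either direction). [folklore] -/
theorem exists_append_cons_of_mem_edges {u v x y : V} (p : G.Walk u v) (h : s(x, y) ∈ p.edges) :
    ∃ (x' y' : V) (q : G.Walk u x') (hxy : G.Adj x' y') (r : G.Walk y' v),
      s(x', y') = s(x, y) ∧ p = q.append (Walk.cons hxy r) := by
  induction p with
  | nil => simp at h
  | cons hadj p ih =>
    rename_i a b c
    rw [Walk.edges_cons, List.mem_cons] at h
    rcases h with h | h
    · exact ⟨a, b, Walk.nil, hadj, p, h.symm, by simp⟩
    · obtain ⟨x', y', q, hxy, r, he, rfl⟩ := ih h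
      exact ⟨x', y', Walk.cons hadj q, hxy, r, he, by simp [Walk.cons_append]⟩

/-- In a path starting with the edge `a → b`, the only edge at `a` is that edge. [folklore] -/
theorem eq_of_mem_edges_cons_of_isPath {a b c x : V} {h : G.Adj a b} {p : G.Walk b c}
    (hp : (Walk.cons h p).IsPath) (hx : s(a, x) ∈ (Walk.cons h p).edges) : x = b := by
  rw [Walk.cons_isPath_iff] at hp
  rw [Walk.edges_cons, List.mem_cons] at hx
  rcases hx with hx | hx
  · exact Sym2.congr_right.mp hx
  · exact absurd (p.fst_mem_support_of_mem_edges hx) hp.2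

/-- In a path from `a`, an edge at `a` is the first edge: the path is `a → x` followed by a path
avoiding `a`. [folklore] -/
theorem exists_eq_cons_of_mem_edges_of_isPath {a c x : V} {p : G.Walk a c} (hp : p.IsPath)
    (hx : s(a, x) ∈ p.edges) :
    ∃ (h : G.Adj a x) (p' : G.Walk x c), p = Walk.cons h p' ∧ p'.IsPath ∧ a ∉ p'.support := by
  cases p with
  | nil => simp at hx
  | cons h p' =>
    have hxb := eq_of_mem_edges_cons_of_isPath hp hx
    subst hxb
    rw [Walk.cons_isPath_iff] at hp
    exact ⟨h, p', rfl, hp.1, hp.2⟩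

/-- **An interior vertex of a self-avoiding path has exactly two incident edges** ("each vertex has
degree 0 or 2"): for `w` on the path, `w ≠ a, b`, there are `x ≠ y` with
`{z | s(w, z) ∈ E(γ)} = {x, y}`. [folklore] -/
theorem exists_edges_eq_pair_of_isPath {a b w : V} {p : G.Walk a b} (hp : p.IsPath)
    (hw : w ∈ p.support) (ha : w ≠ a) (hb : w ≠ b) :
    ∃ x y : V, x ≠ y ∧ ∀ z : V, s(w, z) ∈ p.edges ↔ z = x ∨ z = y := by
  obtain ⟨i, hi, hil⟩ := Walk.mem_support_iff_exists_getVert.mp hw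
  subst hi
  have hi0 : i ≠ 0 := by
    rintro rfl
    exact ha (Walk.getVert_zero p)
  have hil' : i < p.length := lt_of_le_of_ne hil (by
    rintro rfl
    exact hb (Walk.getVert_length p))
  obtain ⟨x, y, hxy, hset⟩ := Set.ncard_eq_two.mp
    (hp.ncard_neighborSet_toSubgraph_internal_eq_two hi0 hil')
  refine ⟨x, y, hxy, fun z => ?_⟩
  have hz : z ∈ p.toSubgraph.neighborSet (p.getVert i) ↔ z = x ∨ z = y := by
    rw [hset]
    simp
  rw [← hz, Subgraph.mem_neighborSet, ← Subgraph.mem_edgeSet, Walk.mem_edges_toSubgraph]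

/-- At most two edges of a self-avoiding path meet at any of its interior vertices: three pairwise
distinct neighbours along path edges are impossible. [folklore] -/
theorem not_three_edges_of_isPath {a b w x y z : V} {p : G.Walk a b} (hp : p.IsPath)
    (ha : w ≠ a) (hb : w ≠ b) (hx : s(w, x) ∈ p.edges) (hy : s(w, y) ∈ p.edges)
    (hz : s(w, z) ∈ p.edges) (hxy : x ≠ y) (hxz : x ≠ z) (hyz : y ≠ z) : False := by
  obtain ⟨x', y', -, h⟩ :=
    exists_edges_eq_pair_of_isPath hp (p.fst_mem_support_of_mem_edges hx) ha hb
  rcases (h x).1 hx with rfl | rfl <;> rcases (h y).1 hy with rfl | rfl <;>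
    rcases (h z).1 hz with rfl | rfl <;> simp_all

/-- A self-avoiding path from `v₁` to `v₂` which is not a single edge does not contain the edge
`s(v₁, v₂)`. [folklore] -/
theorem notMem_edges_of_isPath {v₁ v₂ : V} {l : G.Walk v₁ v₂} (hl : l.IsPath)
    (hlen : l.length ≠ 1) : s(v₁, v₂) ∉ l.edges := by
  intro he
  obtain ⟨h, l', rfl, hl', -⟩ := exists_eq_cons_of_mem_edges_of_isPath hl he
  have : l' = Walk.nil := (Walk.eq_nil_iff_nil).mpr (Walk.isPath_iff_nil.mp hl')
  subst this
  simp at hlen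

/-- The edge set of a self-avoiding path has as many elements as the path has steps. [folklore] -/
theorem card_edges_toFinset_of_isPath [DecidableEq V] {u v : V} {p : G.Walk u v} (hp : p.IsPath) :
    p.edges.toFinset.card = p.length := by
  rw [List.toFinset_card_of_nodup hp.edges_nodup, Walk.length_edges]

/-! ### Splicing a path along a detour -/

section Splice

variable {a b v₁ v₂ : V}

/-- Support of a doubly appended walk. [folklore] -/
theorem support_append_append (α : G.Walk a v₁) (μ : G.Walk v₁ v₂) (β : G.Walk v₂ b) :
    (α.append (μ.append β)).support = α.support ++ (μ.support.tail ++ β.support.tail) := by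
  rw [Walk.support_append, Walk.support_append,
    List.tail_append_of_ne_nil (Walk.support_ne_nil μ)]

/-- **Splicing preserves self-avoidance.** If `α ++ μ ++ β` is a self-avoiding path (`μ : v₁ → v₂`,
`v₁ ≠ v₂`) and `l : v₁ → v₂` is a self-avoiding path meeting it only at `v₁` and `v₂`, then
`α ++ l ++ β` is a self-avoiding path. [folklore] -/
theorem isPath_splice (α : G.Walk a v₁) (μ : G.Walk v₁ v₂) (β : G.Walk v₂ b)
    (hγ : (α.append (μ.append β)).IsPath) (hne : v₁ ≠ v₂) (l : G.Walk v₁ v₂) (hl : l.IsPath)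
    (hdisj : ∀ w ∈ l.support, w ∈ (α.append (μ.append β)).support → w = v₁ ∨ w = v₂) :
    (α.append (l.append β)).IsPath := by
  rw [Walk.isPath_def] at hγ hl ⊢
  rw [support_append_append] at hγ hdisj ⊢
  obtain ⟨hα, hμβ, hαμβ⟩ := List.nodup_append.mp hγ
  obtain ⟨-, hβ, hμβ'⟩ := List.nodup_append.mp hμβ
  have hlcons : l.support = v₁ :: l.support.tail := (Walk.cons_tail_support l).symm
  rw [hlcons, List.nodup_cons] at hl
  obtain ⟨hv₁l, hlt⟩ := hl
  -- `v₂` lies in the tail of `μ`, hence neither in `α` nor in the tail of `β`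
  have hv₂μ : v₂ ∈ μ.support.tail := by
    have h := Walk.end_mem_support μ
    rw [← Walk.cons_tail_support μ, List.mem_cons] at h
    exact h.resolve_left hne.symm
  have hv₂α : v₂ ∉ α.support := fun h =>
    hαμβ v₂ h v₂ (List.mem_append_left _ hv₂μ) rfl
  have hv₂β : v₂ ∉ β.support.tail := fun h => hμβ' v₂ hv₂μ v₂ h rfl
  have hv₁α : v₁ ∈ α.support := Walk.end_mem_support α
  have hmem : ∀ w ∈ l.support.tail, w ∈ l.support := fun w hw => by
    rw [hlcons]; exact List.mem_cons_of_mem _ hw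
  refine List.nodup_append.mpr ⟨hα, List.nodup_append.mpr ⟨hlt, hβ, ?_⟩, ?_⟩
  · -- tail of `l` against tail of `β`
    rintro w hw _ hw' rfl
    rcases hdisj w (hmem w hw)
        (List.mem_append_right _ (List.mem_append_right _ hw')) with rfl | rfl
    · exact hv₁l hw
    · exact hv₂β hw'
  · -- `α` against tail of `l` and tail of `β`
    rintro w hw _ hw' rfl
    rcases List.mem_append.mp hw' with hw' | hw'
    · rcases hdisj w (hmem w hw') (List.mem_append_left _ hw) with rfl | rfl
      · exact hv₁l hw'
      · exact hv₂α hw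
    · exact hαμβ w hw w (List.mem_append_right _ hw') rfl

/-- The vertices of the spliced path are vertices of the old path or of the detour. [folklore] -/
theorem mem_support_splice (α : G.Walk a v₁) (μ : G.Walk v₁ v₂) (β : G.Walk v₂ b)
    (l : G.Walk v₁ v₂) {w : V} (hw : w ∈ (α.append (l.append β)).support) :
    w ∈ (α.append (μ.append β)).support ∨ w ∈ l.support := by
  simp only [Walk.mem_support_append_iff] at hw ⊢
  tauto

/-- The length of the spliced path. [folklore] -/
theorem length_splice (α : G.Walk a v₁) (μ : G.Walk v₁ v₂) (β : G.Walk v₂ b) (l : G.Walk v₁ v₂) :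
    (α.append (l.append β)).length + μ.length = (α.append (μ.append β)).length + l.length := by
  simp only [Walk.length_append]
  omega

/-- **The edge set of the spliced path is the symmetric difference** of the edge set of the old
path with the closed polygon `μ ∪ l` (the printed "symmetric difference … as sets of edges"),
provided the detour `l` shares no edge with `μ`. [folklore] -/
theorem edges_toFinset_splice [DecidableEq V] (α : G.Walk a v₁) (μ : G.Walk v₁ v₂)
    (β : G.Walk v₂ b) (hγ : (α.append (μ.append β)).IsPath) (hne : v₁ ≠ v₂) (l : G.Walk v₁ v₂)
    (hdisj : ∀ w ∈ l.support, w ∈ (α.append (μ.append β)).support → w = v₁ ∨ w = v₂)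
    (hlμ : ∀ e ∈ l.edges, e ∉ μ.edges) :
    (α.append (l.append β)).edges.toFinset =
      symmDiff (α.append (μ.append β)).edges.toFinset (μ.edges.toFinset ∪ l.edges.toFinset) := by
  -- edges of `μ` are not edges of `α` or `β` (edges of a path are pairwise distinct)
  have hnd := Walk.edges_nodup_of_support_nodup ((Walk.isPath_def _).mp hγ)
  rw [Walk.edges_append, Walk.edges_append] at hnd
  obtain ⟨-, hμβ, hαμβ⟩ := List.nodup_append.mp hnd
  obtain ⟨-, -, hμβ'⟩ := List.nodup_append.mp hμβ
  -- support facts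
  have hsupp := (Walk.isPath_def _).mp hγ
  rw [support_append_append] at hsupp
  obtain ⟨-, hμβs, hαμβs⟩ := List.nodup_append.mp hsupp
  have hv₂μ : v₂ ∈ μ.support.tail := by
    have h := Walk.end_mem_support μ
    rw [← Walk.cons_tail_support μ, List.mem_cons] at h
    exact h.resolve_left hne.symm
  have hv₂α : v₂ ∉ α.support := fun h => hαμβs v₂ h v₂ (List.mem_append_left _ hv₂μ) rfl
  have hv₁β : v₁ ∉ β.support := by
    rw [← Walk.cons_tail_support β, List.mem_cons, not_or]
    exact ⟨hne, fun h => hαμβs v₁ (Walk.end_mem_support α) v₁ (List.mem_append_right _ h) rfl⟩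
  have hinα : ∀ w ∈ α.support, w ∈ (α.append (μ.append β)).support := fun w hw =>
    (Walk.mem_support_append_iff _ _).mpr (Or.inl hw)
  have hinβ : ∀ w ∈ β.support, w ∈ (α.append (μ.append β)).support := fun w hw =>
    (Walk.mem_support_append_iff _ _).mpr
      (Or.inr ((Walk.mem_support_append_iff _ _).mpr (Or.inr hw)))
  -- an edge of `l` with both endpoints on the old path is `s(v₁, v₂)`
  have hl12 : ∀ x y : V, s(x, y) ∈ l.edges → x ∈ (α.append (μ.append β)).support →
      y ∈ (α.append (μ.append β)).support → s(x, y) = s(v₁, v₂) := by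
    intro x y he hx hy
    have hne' := (l.adj_of_mem_edges he).ne
    rcases hdisj x (l.fst_mem_support_of_mem_edges he) hx with rfl | rfl <;>
      rcases hdisj y (l.snd_mem_support_of_mem_edges he) hy with rfl | rfl
    · exact absurd rfl hne'
    · rfl
    · exact Sym2.eq_swap
    · exact absurd rfl hne'
  have hlα : ∀ x y : V, s(x, y) ∈ l.edges → s(x, y) ∉ α.edges := by
    intro x y he heα
    rw [hl12 x y he (hinα _ (α.fst_mem_support_of_mem_edges heα))
      (hinα _ (α.snd_mem_support_of_mem_edges heα))] at heα
    exact hv₂α (α.snd_mem_support_of_mem_edges heα)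
  have hlβ : ∀ x y : V, s(x, y) ∈ l.edges → s(x, y) ∉ β.edges := by
    intro x y he heβ
    rw [hl12 x y he (hinβ _ (β.fst_mem_support_of_mem_edges heβ))
      (hinβ _ (β.snd_mem_support_of_mem_edges heβ))] at heβ
    exact hv₁β (β.fst_mem_support_of_mem_edges heβ)
  ext e
  induction e using Sym2.ind with
  | _ x y =>
    simp only [List.mem_toFinset, Walk.edges_append, List.mem_append, Finset.mem_symmDiff,
      Finset.mem_union]
    have h1 := hlα x y
    have h2 := hlβ x y
    have h3 := hlμ s(x, y)
    have h4 : s(x, y) ∈ μ.edges → s(x, y) ∉ α.edges := fun hμ hα' =>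
      hαμβ _ hα' _ (List.mem_append_left _ hμ) rfl
    have h5 : s(x, y) ∈ μ.edges → s(x, y) ∉ β.edges := fun hμ hβ' => hμβ' _ hμ _ hβ' rfl
    constructor
    · rintro (hA | hL | hB)
      · exact Or.inl ⟨Or.inl hA, fun h => h.elim (fun hM => h4 hM hA) (fun hL => h1 hL hA)⟩
      · exact Or.inr ⟨Or.inr hL, fun h => h.elim (h1 hL) (fun h' => h'.elim (h3 hL) (h2 hL))⟩
      · exact Or.inl ⟨Or.inr (Or.inr hB), fun h => h.elim (fun hM => h5 hM hB) (fun hL => h2 hL hB)⟩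
    · rintro (⟨hAMB, hML⟩ | ⟨hML, hAMB⟩)
      · rcases hAMB with hA | hM | hB
        · exact Or.inl hA
        · exact absurd (Or.inl hM) hML
        · exact Or.inr (Or.inr hB)
      · rcases hML with hM | hL
        · exact absurd (Or.inr (Or.inl hM)) hAMB
        · exact Or.inr (Or.inl hL)

end Splice

/-! ### The two printed cases: one shared edge, two adjacent shared edges -/

section Cases

variable [DecidableEq V] {a b v₁ v₂ m : V}

/-- One shared edge, oriented: the path is `α ++ (v₁ → v₂) ++ β`. [folklore] -/
theorem exists_splice_edge_of_eq (α : G.Walk a v₁) (h₁₂ : G.Adj v₁ v₂) (β : G.Walk v₂ b)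
    (hγ : (α.append (Walk.cons h₁₂ β)).IsPath) {l : G.Walk v₁ v₂} (hl : l.IsPath)
    (hlen : l.length ≠ 1)
    (hdisj : ∀ w ∈ l.support, w ∈ (α.append (Walk.cons h₁₂ β)).support → w = v₁ ∨ w = v₂) :
    ∃ γ' : G.Walk a b, γ'.IsPath ∧
      γ'.length + 2 = (α.append (Walk.cons h₁₂ β)).length + (l.length + 1) ∧
      γ'.edges.toFinset =
        symmDiff (α.append (Walk.cons h₁₂ β)).edges.toFinset (insert s(v₁, v₂) l.edges.toFinset) ∧
      ∀ w ∈ γ'.support, w ∈ (α.append (Walk.cons h₁₂ β)).support ∨ w ∈ l.support := by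
  set μ : G.Walk v₁ v₂ := Walk.cons h₁₂ Walk.nil with hμ
  have hγμ : α.append (Walk.cons h₁₂ β) = α.append (μ.append β) := rfl
  rw [hγμ] at hγ hdisj ⊢
  have hne : v₁ ≠ v₂ := h₁₂.ne
  have hlμ : ∀ e ∈ l.edges, e ∉ μ.edges := by
    intro e he heμ
    simp only [hμ, Walk.edges_cons, Walk.edges_nil, List.mem_singleton] at heμ
    subst heμ
    exact notMem_edges_of_isPath hl hlen he
  refine ⟨α.append (l.append β), isPath_splice α μ β hγ hne l hl hdisj, ?_, ?_,
    fun w hw => mem_support_splice α μ β l hw⟩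
  · have := length_splice α μ β l
    simp only [hμ, Walk.length_cons, Walk.length_nil] at this ⊢
    omega
  · rw [edges_toFinset_splice α μ β hγ hne l hdisj hlμ]
    simp [hμ]

/-- **Splicing along one shared edge** ("`ℓ` intersects `γ` … at just one edge"): if the
self-avoiding path `γ : a → b` contains the edge `s(v₁, v₂)` and `l : v₁ → v₂` is a self-avoiding
path, not a single edge, meeting `γ` only at `v₁, v₂`, then there is a self-avoiding path
`γ' : a → b` with `|γ'| = |γ| + |ℓ| - 2` for the polygon `ℓ = l ∪ {s(v₁,v₂)}`, edge set
`E(γ') = E(γ) Δ ℓ`, and vertices among those of `γ` and `l`. [folklore] -/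
theorem exists_splice_edge {γ : G.Walk a b} (hγ : γ.IsPath) (he : s(v₁, v₂) ∈ γ.edges)
    {l : G.Walk v₁ v₂} (hl : l.IsPath) (hlen : l.length ≠ 1)
    (hdisj : ∀ w ∈ l.support, w ∈ γ.support → w = v₁ ∨ w = v₂) :
    ∃ γ' : G.Walk a b, γ'.IsPath ∧ γ'.length + 2 = γ.length + (l.length + 1) ∧
      γ'.edges.toFinset = symmDiff γ.edges.toFinset (insert s(v₁, v₂) l.edges.toFinset) ∧
      ∀ w ∈ γ'.support, w ∈ γ.support ∨ w ∈ l.support := by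
  obtain ⟨x, y, α, hxy, β, hexy, rfl⟩ := exists_append_cons_of_mem_edges γ he
  rcases Sym2.eq_iff.mp hexy.symm with ⟨rfl, rfl⟩ | ⟨rfl, rfl⟩
  · exact exists_splice_edge_of_eq α hxy β hγ hl hlen hdisj
  · -- the edge is traversed from `v₂` to `v₁`: use the reversed detour
    have hdisj' : ∀ w ∈ l.reverse.support, w ∈ (α.append (Walk.cons hxy β)).support →
        w = v₂ ∨ w = v₁ := fun w hw hw' => by
      rw [Walk.support_reverse, List.mem_reverse] at hw
      exact (hdisj w hw hw').symm
    obtain ⟨γ', h1, h2, h3, h4⟩ := exists_splice_edge_of_eq α hxy β hγ hl.reverse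
      (by rwa [Walk.length_reverse]) hdisj'
    refine ⟨γ', h1, by rwa [Walk.length_reverse] at h2, ?_, fun w hw => ?_⟩
    · rw [h3, Walk.edges_reverse, List.toFinset_reverse, Sym2.eq_swap]
    · rcases h4 w hw with h | h
      · exact Or.inl h
      · rw [Walk.support_reverse, List.mem_reverse] at h
        exact Or.inr h

/-- Two adjacent shared edges, oriented: the path is `α ++ (v₁ → m → v₂) ++ β`. [folklore] -/
theorem exists_splice_two_edges_of_eq (α : G.Walk a v₁) (h₁ : G.Adj v₁ m) (h₂ : G.Adj m v₂)
    (β : G.Walk v₂ b) (hγ : (α.append (Walk.cons h₁ (Walk.cons h₂ β))).IsPath) (hne : v₁ ≠ v₂)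
    {l : G.Walk v₁ v₂} (hl : l.IsPath) (hml : m ∉ l.support)
    (hdisj : ∀ w ∈ l.support, w ∈ (α.append (Walk.cons h₁ (Walk.cons h₂ β))).support →
      w = v₁ ∨ w = v₂) :
    ∃ γ' : G.Walk a b, γ'.IsPath ∧
      γ'.length + 4 = (α.append (Walk.cons h₁ (Walk.cons h₂ β))).length + (l.length + 2) ∧
      γ'.edges.toFinset =
        symmDiff (α.append (Walk.cons h₁ (Walk.cons h₂ β))).edges.toFinset
          (insert s(v₁, m) (insert s(m, v₂) l.edges.toFinset)) ∧
      ∀ w ∈ γ'.support, w ∈ (α.append (Walk.cons h₁ (Walk.cons h₂ β))).support ∨ w ∈ l.support := by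
  set μ : G.Walk v₁ v₂ := Walk.cons h₁ (Walk.cons h₂ Walk.nil) with hμ
  have hγμ : α.append (Walk.cons h₁ (Walk.cons h₂ β)) = α.append (μ.append β) := rfl
  rw [hγμ] at hγ hdisj ⊢
  have hlμ : ∀ e ∈ l.edges, e ∉ μ.edges := by
    intro e he heμ
    simp only [hμ, Walk.edges_cons, Walk.edges_nil, List.mem_cons, List.not_mem_nil,
      or_false] at heμ
    rcases heμ with rfl | rfl
    · exact hml (l.snd_mem_support_of_mem_edges he)
    · exact hml (l.fst_mem_support_of_mem_edges he)
  refine ⟨α.append (l.append β), isPath_splice α μ β hγ hne l hl hdisj, ?_, ?_,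
    fun w hw => mem_support_splice α μ β l hw⟩
  · have := length_splice α μ β l
    simp only [hμ, Walk.length_cons, Walk.length_nil] at this ⊢
    omega
  · rw [edges_toFinset_splice α μ β hγ hne l hdisj hlμ]
    simp [hμ]

/-- Two adjacent shared edges, half-oriented: the path is `α ++ (v₁ → m) ++ β₀` and contains the
edge `s(m, v₂)`; then `β₀` starts with `m → v₂`. [folklore] -/
theorem exists_splice_two_edges_of_eq' (α : G.Walk a v₁) (h₁ : G.Adj v₁ m) (β₀ : G.Walk m b)
    (hγ : (α.append (Walk.cons h₁ β₀)).IsPath) (h₂ : s(m, v₂) ∈ (α.append (Walk.cons h₁ β₀)).edges)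
    (hne : v₁ ≠ v₂) (hmb : m ≠ b) {l : G.Walk v₁ v₂} (hl : l.IsPath) (hml : m ∉ l.support)
    (hdisj : ∀ w ∈ l.support, w ∈ (α.append (Walk.cons h₁ β₀)).support → w = v₁ ∨ w = v₂) :
    ∃ γ' : G.Walk a b, γ'.IsPath ∧
      γ'.length + 4 = (α.append (Walk.cons h₁ β₀)).length + (l.length + 2) ∧
      γ'.edges.toFinset =
        symmDiff (α.append (Walk.cons h₁ β₀)).edges.toFinset
          (insert s(v₁, m) (insert s(m, v₂) l.edges.toFinset)) ∧
      ∀ w ∈ γ'.support, w ∈ (α.append (Walk.cons h₁ β₀)).support ∨ w ∈ l.support := by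
  -- `β₀` is not trivial (`m ≠ b`): `β₀ = m → y` followed by `β`
  cases β₀ with
  | nil => exact absurd rfl hmb
  | cons h₂' β =>
    rename_i y
    -- the successor `y` of `m` is `v₂`: otherwise `m` has the three neighbours `v₁, y, v₂`
    have hma : m ≠ a := by
      intro hma
      have hsupp := (Walk.isPath_def _).mp hγ
      rw [Walk.support_append] at hsupp
      have := (List.nodup_append.mp hsupp).2.2 a (hma ▸ Walk.start_mem_support α)
        m (by simp) 
      exact this hma.symm
    have hy : y = v₂ := by
      by_contra hyv
      have hsupp := (Walk.isPath_def _).mp hγ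
      rw [Walk.support_append] at hsupp
      have hv₁y : v₁ ≠ y := (List.nodup_append.mp hsupp).2.2 v₁ (Walk.end_mem_support α) y
        (by simp)
      refine not_three_edges_of_isPath hγ (w := m) hma hmb (x := v₁) (y := y) (z := v₂) ?_ ?_ h₂
        hv₁y hne hyv
      · rw [Sym2.eq_swap]
        simp [Walk.edges_append]
      · simp [Walk.edges_append]
    subst hy
    exact exists_splice_two_edges_of_eq α h₁ h₂' β hγ hne hl hml hdisj

/-- **Splicing along two adjacent shared edges** ("… or at two adjacent edges only"): if the
self-avoiding path `γ : a → b` contains the edges `s(v₁, m)` and `s(m, v₂)` (`v₁ ≠ v₂`, `m` not an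
endpoint of `γ`) and `l : v₁ → v₂` is a self-avoiding path avoiding `m` and meeting `γ` only at
`v₁, v₂`, then there is a self-avoiding path `γ' : a → b` with `|γ'| = |γ| + |ℓ| - 4` for the
polygon `ℓ = l ∪ {s(v₁,m), s(m,v₂)}`, edge set `E(γ') = E(γ) Δ ℓ`, and vertices among those of
`γ` and `l`. [folklore] -/
theorem exists_splice_two_edges {γ : G.Walk a b} (hγ : γ.IsPath) (h₁ : s(v₁, m) ∈ γ.edges)
    (h₂ : s(m, v₂) ∈ γ.edges) (hne : v₁ ≠ v₂) (hma : m ≠ a) (hmb : m ≠ b)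
    {l : G.Walk v₁ v₂} (hl : l.IsPath) (hml : m ∉ l.support)
    (hdisj : ∀ w ∈ l.support, w ∈ γ.support → w = v₁ ∨ w = v₂) :
    ∃ γ' : G.Walk a b, γ'.IsPath ∧ γ'.length + 4 = γ.length + (l.length + 2) ∧
      γ'.edges.toFinset =
        symmDiff γ.edges.toFinset (insert s(v₁, m) (insert s(m, v₂) l.edges.toFinset)) ∧
      ∀ w ∈ γ'.support, w ∈ γ.support ∨ w ∈ l.support := by
  obtain ⟨x, y, α, hxy, β₀, hexy, rfl⟩ := exists_append_cons_of_mem_edges γ h₁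
  rcases Sym2.eq_iff.mp hexy.symm with ⟨rfl, rfl⟩ | ⟨rfl, rfl⟩
  · exact exists_splice_two_edges_of_eq' α hxy β₀ hγ h₂ hne hmb hl hml hdisj
  · -- `γ` traverses `m → v₁`: reverse `γ`, splice, and reverse back
    have hrev : (α.append (Walk.cons hxy β₀)).reverse =
        β₀.reverse.append (Walk.cons hxy.symm α.reverse) := by
      rw [Walk.reverse_append, Walk.reverse_cons, ← Walk.append_assoc]
      rfl
    have hγr_path : (β₀.reverse.append (Walk.cons hxy.symm α.reverse)).IsPath :=
      hrev ▸ hγ.reverse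
    have h₂r : s(m, v₂) ∈ (β₀.reverse.append (Walk.cons hxy.symm α.reverse)).edges := by
      rw [← hrev, Walk.edges_reverse, List.mem_reverse]; exact h₂
    have hdisjr : ∀ w ∈ l.support, w ∈ (β₀.reverse.append (Walk.cons hxy.symm α.reverse)).support →
        w = v₁ ∨ w = v₂ := fun w hw hw' => by
      rw [← hrev, Walk.support_reverse, List.mem_reverse] at hw'
      exact hdisj w hw hw'
    obtain ⟨γ', hp, hlen, hedges, hsup⟩ :=
      exists_splice_two_edges_of_eq' β₀.reverse hxy.symm α.reverse hγr_path h₂r hne hma hl hml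
        hdisjr
    rw [← hrev] at hlen hedges hsup
    refine ⟨γ'.reverse, hp.reverse, ?_, ?_, fun w hw => ?_⟩
    · rw [Walk.length_reverse, hlen, Walk.length_reverse]
    · rw [Walk.edges_reverse, List.toFinset_reverse, hedges, Walk.edges_reverse,
        List.toFinset_reverse]
    · rw [Walk.support_reverse, List.mem_reverse] at hw
      rcases hsup w hw with h | h
      · rw [Walk.support_reverse, List.mem_reverse] at h
        exact Or.inl h
      · exact Or.inr h

end Cases

/-! ### A cycle through an edge is the edge plus a path -/

/-- A cycle based at `p` through the edge `s(p, q)` is that edge followed (or preceded) by a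
self-avoiding path from `q` back to `p`: there is a self-avoiding `ρ : p → q` with the remaining
edges. [folklore] -/
theorem exists_path_of_isCycle_of_mem_edges [DecidableEq V] {p q : V} {c : G.Walk p p}
    (hc : c.IsCycle) (he : s(p, q) ∈ c.edges) :
    ∃ ρ : G.Walk p q, ρ.IsPath ∧ ρ.length + 1 = c.length ∧
      ρ.edges.toFinset = c.edges.toFinset.erase s(p, q) ∧ ∀ w ∈ ρ.support, w ∈ c.support := by
  have h3 := hc.three_le_length
  cases c with
  | nil => simp at he
  | cons h r =>
    rename_i y
    rw [Walk.cons_isCycle_iff] at hc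
    rw [Walk.edges_cons, List.mem_cons] at he
    by_cases hqy : q = y
    · subst hqy
      refine ⟨r.reverse, hc.1.reverse, by simp [Walk.length_cons], ?_, fun w hw => ?_⟩
      · rw [Walk.edges_reverse, List.toFinset_reverse, Walk.edges_cons, List.toFinset_cons,
          Finset.erase_insert (fun h' => hc.2 (List.mem_toFinset.mp h'))]
      · rw [Walk.support_reverse, List.mem_reverse] at hw
        simp [hw]
    · have he' : s(p, q) ∈ r.edges := he.resolve_left (fun h' => hqy (Sym2.congr_right.mp h'))
      have her : s(p, q) ∈ r.reverse.edges := by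
        rw [Walk.edges_reverse, List.mem_reverse]; exact he'
      obtain ⟨hpq, π, hπeq, hπ, hpπ⟩ := exists_eq_cons_of_mem_edges_of_isPath hc.1.reverse her
      have hEr : r.edges.toFinset = insert s(p, q) π.edges.toFinset := by
        rw [← List.toFinset_reverse, ← Walk.edges_reverse, hπeq, Walk.edges_cons,
          List.toFinset_cons]
      have hpqπ : s(p, q) ∉ π.edges.toFinset := fun h' =>
        hpπ (π.fst_mem_support_of_mem_edges (List.mem_toFinset.mp h'))
      have hne : s(p, q) ≠ s(p, y) := fun h' => hqy (Sym2.congr_right.mp h')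
      refine ⟨Walk.cons h π.reverse, ?_, ?_, ?_, fun w hw => ?_⟩
      · rw [Walk.cons_isPath_iff]
        refine ⟨hπ.reverse, ?_⟩
        rw [Walk.support_reverse, List.mem_reverse]
        exact hpπ
      · have : r.length = π.length + 1 := by
          rw [← Walk.length_reverse, hπeq, Walk.length_cons]
        simp [Walk.length_cons, this]
      · rw [Walk.edges_cons, List.toFinset_cons, Walk.edges_reverse, List.toFinset_reverse,
          Walk.edges_cons, List.toFinset_cons, hEr, Finset.insert_comm,
          Finset.erase_insert]
        simp only [Finset.mem_insert, not_or]
        exact ⟨hne, hpqπ⟩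
      · rw [Walk.support_cons, List.mem_cons, Walk.support_reverse, List.mem_reverse] at hw
        rw [Walk.support_cons, List.mem_cons]
        rcases hw with rfl | hw
        · exact Or.inl rfl
        · right
          have : w ∈ r.reverse.support := by
            rw [hπeq, Walk.support_cons, List.mem_cons]; exact Or.inr hw
          rwa [Walk.support_reverse, List.mem_reverse] at this

end Literature.Combinatorics.SimpleGraph
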